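import Summits.QuantumFields.YangMills.Theorems.BalabanUVNodesN12RootedForestGeodesic
import Summits.QuantumFields.YangMills.Theorems.BalabanUVNodesN07CritMultiScaleLamBond
import Literature.MathematicalPhysics.QuantumFieldTheory.BalabanImbrieJaffe1984to88.BIJ85ScalarPropagatorSupDecayDeriv
import HarnessLib

/-!
# BalabanUVNodes ∕ N12 — THE TOWER-CONFINED FOREST (the «cut hierarchical comb» of dag-n12-w6's LOCATED-COMB, realised as a genuine fine forest): every fine site hangs from the centre of
# the LOWEST block of its tower that is a root, by a path that STAYS INSIDE THAT BLOCK — hence inside every block of the tower whose centre is a root — of length at most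
# `Σ_{i ≤ j} (d·(L^i − 1)∕2 + 1)`; with (F1), (F2), (TREE) as in `N12RootedForest`, at any `𝐁` under the coverage letter (Cov) and at the record's `𝐁_k(Z)` for every `Z`

Cell `pub-ymgap` (HUMAN RULINGS D-0062 ∕ D-0149), WIDTH SEAT `pub-ymgap-dag-n12-w3` g3 (node N12 = [B15]; key K1⁸ `stmt-QuantumFields-26907`, `--kind proof --supports … --as helper`;
count-neutral).  THEOREMS ONLY (0 `def`, 0 `instance`, 0 `sorry`); consumed BY NAME: this seat's `N12RootedForest.forest_F1`, `N12RootedForestGeodesic.tdist_embIter_iterBlockOf_le`,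
`N12FlatHndRecordLetters.hcov_Bj` (p608348); `B5Eq118OneStroke.val_iterBlockOf`, the route UnitScaleTilt's `Prop7TentInterpolation.val_embIter` ∕ `Prop7FlatHolonomy.sitesPerDir_zero_eq_mul_pow`,
`T4Continuum.walkEnd`, `Site.shift_unshift` ∕ `unshift_shift`; n07's `N07CritMultiScaleLamBond.iterBlockOf_congr_of_le` (nested blocks) and
`BIJ85ScalarPropagatorSupDecayDeriv.two_mul_pow_le_sitesPerDir` (`2L^j ≤ N₀`) — cited, not restated (gate `dedup.landed` on v1).

WHY.  The breadth-first forest of `N12RootedForest` ∕ `N12RootedForestGeodesic` has the optimal LENGTH bound but its paths may leave the block tower of their root.  dag-n12-w6's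
LOCATED-COMB (iii) and dag-n12-c's (q2) «Poincaré-in-towers» want the other geometry: paths CONFINED to block towers, so that a bond between two sites of one basin closes a loop inside
one block.  Print's hierarchical comb straightened on the fine lattice is not a forest (this seat's LOCATED-GAUGE); the forest typed here is its honest fine-lattice substitute: for a fine
site `z` let `n(z)` be the LEAST level `j ≤ k` whose tower centre `embIter j (iterBlockOf j z)` is a root (exists under (Cov)); the parent of `z ∉ R` is the neighbour of `z` one step
closer to that centre IN THE SAME `n(z)`-BLOCK (move the first differing label one unit toward the centre's label — no wrap inside a block); the rank `Φ(z) = tdist(z, centre) +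
Σ_{i < n(z)} (d·(L^i − 1)∕2 + 1)` strictly decreases along parents (same level: the distance drops; lower level: the partial sum drops), so `N12RootedForestGeodesic`'s ranked-forest
construction applies verbatim and the path of `z` — every step of it — stays in the `n(z)`-block of `z`, hence in every `j`-block of `z` whose centre is a root (`j ≥ n(z)` by
minimality, blocks are nested).

CONTENTS.  §1 label arithmetic: `min_val_sub_eq_of_le` (the torus summand equals the label difference when twice it is at most the period),
★★ `exists_parent_toward_centre` (the in-block step: a neighbour `z′` with `walkEnd z′ [l] = z`, same `j`-block, `tdist z′ c + 1 = tdist z c`).  §2 ★★ `exists_forest_of_rankedParents`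
(the ranked-forest construction with an EDGE PREDICATE threaded: (F2) ∧ (TREE with the predicate and the rank drop) ∧ `(path x).length ≤ ρ x`).  §3 ★★★ `exists_towerForest` (any `𝐁`, `k ≤ m + K`,
(Cov): (F1) ∧ (F2) ∧ (TREE) ∧ (TOWER) «`embIter j (iterBlockOf j z) ∈ R(𝐁, k)` ⟹ every step of `path z` has both ends in the `j`-block of `z`» ∧ (LEN) «… ⟹ `(path z).length ≤ Σ_{i ≤ j}
(d·(L^i − 1)∕2 + 1)`»), ★★★ `exists_towerForest_Bj` (the record, every `Z`, with `hcov_Bj`; the member form `iterBlockOf j z ∈ 𝐁_k(Z) j ⟹ …`).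

HONEST FRAMING.  Finite combinatorics and label arithmetic; a fine-lattice tree gauge geometry in place of print's block-hierarchical averaged `Ax_k` ([Balaban1985RegularSpaces] (1.19));
no analysis, no constants of Bałaban's; N12 NOT discharged; K1⁸ NOT closed; counts unmoved (typed 28∕28 · discharged 5∕27); one finite 𝕋⁴ programme at fixed ε — R4 closes the
conditional rung `BalabanLadder.UV` only; the Yang–Mills mass gap (Clay) is NOT proved by any of this; nothing continuum ∕ ℝ⁴ ∕ OS.
-/

noncomputable section

namespace Summit.QuantumFields.YangMills.BalabanUVNodes.N12TowerForest

open scoped BigOperators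
open Literature.MathematicalPhysics.QuantumFieldTheory.Balaban1983to89
open T4Continuum
open B15DeterminingSets
open B5Eq118OneStroke (iterBlockOf iterBlockOf_succ val_iterBlockOf)
open Summit.QuantumFields.YangMills.Theorems.Prop7TentInterpolation (val_embIter)
open Summit.QuantumFields.YangMills.Theorems.Prop7FlatHolonomy (sitesPerDir_zero_eq_mul_pow)
open Summit.QuantumFields.YangMills.BalabanUVNodes.N12RootedForest (forest_F1)
open Summit.QuantumFields.YangMills.BalabanUVNodes.N12RootedForestGeodesic (tdist_embIter_iterBlockOf_le)
open Summit.QuantumFields.YangMills.BalabanUVNodes.N07CritMultiScaleLamBond (iterBlockOf_congr_of_le)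
open Literature.MathematicalPhysics.QuantumFieldTheory.BalabanImbrieJaffe1984to88.BIJ85ScalarPropagatorSupDecayDeriv (two_mul_pow_le_sitesPerDir)

variable {P : Params}

/-! ## §1 Label arithmetic and the in-block step toward the centre -/

section Labels

/-- The torus summand `min ((a − c) mod n) ((c − a) mod n)` equals the label difference `a − c` when `c ≤ a` (as labels) and twice the difference is at most the period. [folklore] -/
theorem min_val_sub_eq_of_le {n : ℕ} [NeZero n] {a c : ZMod n} (hle : c.val ≤ a.val) (h2 : 2 * (a.val - c.val) ≤ n) :
    min (a - c).val (c - a).val = a.val - c.val := by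
  have hac : (a - c).val = a.val - c.val := ZMod.val_sub hle
  rw [hac]
  refine min_eq_left ?_
  by_cases h0 : a = c
  · subst h0
    simp
  · have hne : a - c ≠ 0 := sub_ne_zero.2 h0
    have hca : (c - a).val = n - (a - c).val := by
      rw [← neg_sub, ZMod.neg_val, if_neg hne]
    rw [hca, hac]
    omega

/-- ★★ **THE IN-BLOCK STEP TOWARD THE CENTRE**: if a fine site `z` is not the centre `c = embIter j (iterBlockOf j z)` of its `j`-block (`j ≤ m + K`), then it has a lattice neighbour `z′` IN THE
SAME `j`-BLOCK, one unit closer to `c` in the torus distance, with `z` one oriented step from `z′` (move the first label of `z` differing from `c`'s one unit toward it — no wrap inside a block,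
since the difference is at most half a block and the period is at least two blocks). [cite: Balaban1987RG1, (0.1)–(0.3) pp.251–252; Balaban1985RegularSpaces, (1.19) p.79 (the comb step; bookkeeping)] -/
theorem exists_parent_toward_centre {j : ℕ} (hj : j ≤ P.m + P.K) {z : Site P 0} (hne : z ≠ embIter j (iterBlockOf j z)) :
    ∃ (z' : Site P 0) (l : Letter P.d), walkEnd z' [l] = z ∧ iterBlockOf j z' = iterBlockOf j z ∧
      Site.tdist z' (embIter j (iterBlockOf j z)) + 1 = Site.tdist z (embIter j (iterBlockOf j z)) := by
  classical
  set c := embIter j (iterBlockOf j z) with hc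
  have hL : 0 < P.L ^ j := pow_pos P.L_pos j
  have hodd : P.L ^ j % 2 = 1 := Nat.odd_iff.mp (Odd.pow P.hL.1)
  have hN := two_mul_pow_le_sitesPerDir (P := P) hj
  have hN1 : 1 < P.sitesPerDir 0 := by omega
  have h1 : (1 : ZMod (P.sitesPerDir 0)).val = 1 := by rw [ZMod.val_one_eq_one_mod, Nat.mod_eq_of_lt hN1]
  -- a coordinate where `z` and `c` differ
  obtain ⟨μ, hμ⟩ : ∃ μ, z μ ≠ c μ := Function.ne_iff.mp hne
  -- labels in coordinate `μ`: `a = A + r` (`A = (a ∕ L^j)·L^j`, `r < L^j`), `b = A + H` (`2H + 1 = L^j`)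
  obtain ⟨a, ha⟩ : ∃ a : ℕ, (z μ).val = a := ⟨_, rfl⟩
  obtain ⟨b, hb⟩ : ∃ b : ℕ, (c μ).val = b := ⟨_, rfl⟩
  obtain ⟨A, hA⟩ : ∃ A : ℕ, a / P.L ^ j * P.L ^ j = A := ⟨_, rfl⟩
  obtain ⟨H, hH⟩ : ∃ H : ℕ, (P.L ^ j - 1) / 2 = H := ⟨_, rfl⟩
  have hh : 2 * H + 1 = P.L ^ j := by omega
  have hcval : b = A + H := by
    rw [← hb, hc, val_embIter hj, val_iterBlockOf j hj, ha, hA, hH]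
  obtain ⟨r, hr⟩ : ∃ r : ℕ, a % P.L ^ j = r := ⟨_, rfl⟩
  have hdm : A + r = a := by rw [← hA, ← hr]; exact Nat.div_add_mod' a (P.L ^ j)
  have hml : r < P.L ^ j := hr ▸ Nat.mod_lt a hL
  have hvne : a ≠ b := fun h => hμ (ZMod.val_injective _ (by rw [ha, hb, h]))
  have hzlt : a < P.sitesPerDir 0 := ha ▸ ZMod.val_lt (z μ)
  have hclt : b < P.sitesPerDir 0 := hb ▸ ZMod.val_lt (c μ)
  -- the summands of `tdist` off the coordinate `μ` do not change under a step in direction `μ`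
  have hrest : ∀ w : Site P 0, (∀ ν, ν ≠ μ → w ν = z ν) →
      ∑ ν ∈ Finset.univ.erase μ, min (w ν - c ν).val (c ν - w ν).val = ∑ ν ∈ Finset.univ.erase μ, min (z ν - c ν).val (c ν - z ν).val := fun w hw =>
    Finset.sum_congr rfl fun ν hν => by rw [Finset.mem_erase] at hν; rw [hw ν hν.1]
  have htd : ∀ w : Site P 0, Site.tdist w c = min (w μ - c μ).val (c μ - w μ).val + ∑ ν ∈ Finset.univ.erase μ, min (w ν - c ν).val (c ν - w ν).val := fun w => by
    unfold Site.tdist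
    rw [← Finset.add_sum_erase _ _ (Finset.mem_univ μ)]
  -- same block: a label in `[A, A + L^j)` in coordinate `μ`, the same label elsewhere
  have hblk : ∀ w : Site P 0, (∀ ν, ν ≠ μ → w ν = z ν) → A ≤ (w μ).val → (w μ).val < A + P.L ^ j → iterBlockOf j w = iterBlockOf j z := fun w hw hlo hhi => by
    funext ν
    apply ZMod.val_injective
    rw [val_iterBlockOf j hj, val_iterBlockOf j hj]
    by_cases hν : ν = μ
    · subst hν
      rw [ha]
      rw [← hA] at hlo hhi
      exact Nat.div_eq_of_lt_le hlo (by rwa [Nat.add_mul, one_mul])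
    · rw [hw ν hν]
  rcases lt_or_gt_of_ne hvne with hab | hba
  · -- `a < b`: the parent is `z′ = z + e_μ` (label `a + 1 ≤ b`), and `z = z′ − e_μ`
    have hval : ((z.shift μ) μ).val = a + 1 := by
      simp only [Site.shift, Function.update_self]
      rw [ZMod.val_add_of_lt (by rw [h1]; omega), h1, ha]
    have hoff : ∀ ν, ν ≠ μ → (z.shift μ) ν = z ν := fun ν hν => by simp only [Site.shift, Function.update_of_ne hν]
    refine ⟨z.shift μ, (μ, false), ?_, hblk _ hoff (by rw [hval]; omega) (by rw [hval]; omega), ?_⟩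
    · show (z.shift μ).unshift μ = z
      exact Site.unshift_shift z μ
    · have hsz : min (z μ - c μ).val (c μ - z μ).val = b - a := by
        rw [min_comm]
        have h := min_val_sub_eq_of_le (a := c μ) (c := z μ) (by rw [ha, hb]; omega) (by rw [ha, hb]; omega)
        rw [ha, hb] at h
        exact h
      have hsz' : min ((z.shift μ) μ - c μ).val (c μ - (z.shift μ) μ).val = b - (a + 1) := by
        rw [min_comm]
        have h := min_val_sub_eq_of_le (a := c μ) (c := (z.shift μ) μ) (by rw [hval, hb]; omega) (by rw [hval, hb]; omega)
        rw [hval, hb] at h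
        exact h
      rw [htd, htd, hsz, hsz', hrest _ hoff]
      omega
  · -- `b < a`: the parent is `z′ = z − e_μ` (label `a − 1 ≥ b`), and `z = z′ + e_μ`
    have hval : ((z.unshift μ) μ).val = a - 1 := by
      simp only [Site.unshift, Function.update_self]
      rw [ZMod.val_sub (by rw [h1]; omega), h1, ha]
    have hoff : ∀ ν, ν ≠ μ → (z.unshift μ) ν = z ν := fun ν hν => by simp only [Site.unshift, Function.update_of_ne hν]
    refine ⟨z.unshift μ, (μ, true), ?_, hblk _ hoff (by rw [hval]; omega) (by rw [hval]; omega), ?_⟩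
    · show (z.unshift μ).shift μ = z
      exact Site.shift_unshift z μ
    · have hsz : min (z μ - c μ).val (c μ - z μ).val = a - b := by
        have h := min_val_sub_eq_of_le (a := z μ) (c := c μ) (by rw [ha, hb]; omega) (by rw [ha, hb]; omega)
        rw [ha, hb] at h
        exact h
      have hsz' : min ((z.unshift μ) μ - c μ).val (c μ - (z.unshift μ) μ).val = (a - 1) - b := by
        have h := min_val_sub_eq_of_le (a := (z.unshift μ) μ) (c := c μ) (by rw [hval, hb]; omega) (by rw [hval, hb]; omega)
        rw [hval, hb] at h
        exact h
      rw [htd, htd, hsz, hsz', hrest _ hoff]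
      omega

end Labels

/-! ## §2 The ranked-forest construction with an edge predicate -/

section Ranked

variable {j : ℕ}

/-- ★★ **A ROOTED FOREST FROM RANKED PARENTS, WITH AN EDGE PREDICATE**: if every non-root `x` has a lattice neighbour `x′` of smaller rank with `E x′ x`, then there is a rooted forest in the
`path` currency with (F2) on `R`, (TREE) every non-root hanging from such a parent by its last oriented step (the predicate and the rank drop recorded), and `(path x).length ≤ ρ x`
(the construction of `N12RootedForestGeodesic.exists_geodesicForest`, layer by layer of the rank). [folklore] -/
theorem exists_forest_of_rankedParents (R : Set (Site P j)) (ρ : Site P j → ℕ) (E : Site P j → Site P j → Prop)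
    (hpar : ∀ x, x ∉ R → ∃ (x' : Site P j) (l : Letter P.d), ρ x' < ρ x ∧ walkEnd x' [l] = x ∧ E x' x) :
    ∃ path : Site P j → List (LStep P j), (∀ r ∈ R, path r = []) ∧
      (∀ x, x ∉ R → ∃ (x' : Site P j) (s : LStep P j), path x = path x' ++ [s] ∧
        ((s.fwd = true → s.bond.src = x' ∧ s.bond.tgt = x) ∧ (s.fwd = false → s.bond.src = x ∧ s.bond.tgt = x')) ∧ E x' x ∧ ρ x' < ρ x) ∧
      (∀ x, (path x).length ≤ ρ x) := by
  classical
  have hstep : ∀ (x' : Site P j) (l : Letter P.d), ∃ s : LStep P j,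
      (s.fwd = true → s.bond.src = x' ∧ s.bond.tgt = walkEnd x' [l]) ∧ (s.fwd = false → s.bond.src = walkEnd x' [l] ∧ s.bond.tgt = x') := by
    rintro x' ⟨μ, b⟩
    cases b
    · exact ⟨⟨⟨x'.unshift μ, μ⟩, false⟩, fun h => absurd h Bool.false_ne_true, fun _ => ⟨rfl, Site.shift_unshift x' μ⟩⟩
    · exact ⟨⟨⟨x', μ⟩, true⟩, fun _ => ⟨rfl, rfl⟩, fun h => absurd h (by simp)⟩
  have hpar' : ∀ x : Site P j, ∃ (x' : Site P j) (s : LStep P j), x ∉ R → ρ x' < ρ x ∧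
      ((s.fwd = true → s.bond.src = x' ∧ s.bond.tgt = x) ∧ (s.fwd = false → s.bond.src = x ∧ s.bond.tgt = x')) ∧ E x' x := by
    intro x
    by_cases hxR : x ∈ R
    · exact ⟨x, ⟨⟨x, ⟨0, P.hd⟩⟩, true⟩, fun h => absurd hxR h⟩
    · obtain ⟨x', l, hlt, hx, hE⟩ := hpar x hxR
      obtain ⟨s, hs⟩ := hstep x' l
      subst hx
      exact ⟨x', s, fun _ => ⟨hlt, hs, hE⟩⟩
  choose par st hps using hpar'
  have hlayer : ∀ n : ℕ, ∃ path : Site P j → List (LStep P j),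
      (∀ x, ρ x ≤ n → x ∉ R → ∃ (x' : Site P j) (s : LStep P j), path x = path x' ++ [s] ∧
        ((s.fwd = true → s.bond.src = x' ∧ s.bond.tgt = x) ∧ (s.fwd = false → s.bond.src = x ∧ s.bond.tgt = x')) ∧ E x' x ∧ ρ x' < ρ x) ∧
      (∀ x, (n < ρ x ∨ x ∈ R) → path x = []) ∧ (∀ x, (path x).length ≤ ρ x) := by
    intro n
    induction n with
    | zero =>
      refine ⟨fun _ => [], fun x hx hxR => ?_, fun _ _ => rfl, fun _ => Nat.zero_le _⟩
      obtain ⟨hlt, -⟩ := hps x hxR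
      omega
    | succ n ih =>
      obtain ⟨path, htree, hnil, hlen⟩ := ih
      refine ⟨fun x => if ρ x = n + 1 ∧ x ∉ R then path (par x) ++ [st x] else path x, fun x hx hxR => ?_, fun x hx => ?_, fun x => ?_⟩
      · by_cases hρx : ρ x = n + 1
        · obtain ⟨hlt, hor, hE⟩ := hps x hxR
          refine ⟨par x, st x, ?_, hor, hE, hlt⟩
          have hp : ¬(ρ (par x) = n + 1 ∧ par x ∉ R) := fun h => by omega
          dsimp only
          rw [if_pos ⟨hρx, hxR⟩, if_neg hp]
        · obtain ⟨x', s, hpx, hor, hE, hlt⟩ := htree x (by omega) hxR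
          refine ⟨x', s, ?_, hor, hE, hlt⟩
          have h1 : ¬(ρ x = n + 1 ∧ x ∉ R) := fun h => hρx h.1
          have h2 : ¬(ρ x' = n + 1 ∧ x' ∉ R) := fun h => by omega
          dsimp only
          rw [if_neg h1, if_neg h2, hpx]
      · have h1 : ¬(ρ x = n + 1 ∧ x ∉ R) := by
          rintro ⟨h, h'⟩
          rcases hx with hx | hx
          · omega
          · exact h' hx
        dsimp only
        rw [if_neg h1]
        exact hnil x (hx.imp (fun h => by omega) id)
      · dsimp only
        split_ifs with h
        · rw [List.length_append, List.length_singleton]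
          have := hlen (par x)
          have := (hps x h.2).1
          omega
        · exact hlen x
  obtain ⟨path, htree, hnil, hlen⟩ := hlayer (Finset.univ.sup ρ)
  exact ⟨path, fun r hr => hnil r (Or.inr hr), fun x hxR => htree x (Finset.le_sup (Finset.mem_univ x)) hxR, hlen⟩

end Ranked

/-! ## §3 The tower-confined forest at a determining set and at the record -/

section Tower

open Literature.MathematicalPhysics.QuantumFieldTheory.Balaban1983to89.B14.Eq213DetSet (Bj)
open Literature.MathematicalPhysics.QuantumFieldTheory.Balaban1983to89.B14.Eq213MaximalDomains (side)

/-- ★★★ **THE TOWER-CONFINED FOREST.**  For a determining set `𝐁` read up to `k ≤ m + K` under the coverage letter (Cov) «every fine site lies in the block tower of a member», there is a rooted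
forest in the `path` currency with (F1), (F2), (TREE) at `R(𝐁, k)` AND: (TOWER) whenever the centre of the `j`-block of `z` is a root (`j ≤ k`), EVERY STEP of `path z` has both ends in the
`j`-block of `z`; (LEN) then `(path z).length ≤ Σ_{i ≤ j} (d·(L^i − 1)∕2 + 1)`.  Construction: `z ∉ R` hangs from the neighbour one unit closer, inside the block, to the centre of the LOWEST block
of its tower whose centre is a root (`exists_parent_toward_centre`); rank `tdist(z, that centre) + Σ_{i < level} (d·(L^i − 1)∕2 + 1)`.  dag-n12-w6's LOCATED-COMB (iii) «cut hierarchical comb»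
as an honest fine forest. [cite: Balaban1985RegularSpaces, (1.14) p.78, (1.19) p.79; Balaban1985Variational, (4) p.278, (16)–(18) p.280; Balaban1988Convergent, (2.2) p.255, (2.13) pp.256–257; Balaban1987RG1, (0.1)–(0.3) pp.251–252] -/
theorem exists_towerForest (𝔹 : DetSet P) {k : ℕ} (hk : k ≤ P.m + P.K) (hcov : ∀ z : Site P 0, ∃ j, j ≤ k ∧ iterBlockOf j z ∈ 𝔹 j) :
    ∃ path : Site P 0 → List (LStep P 0),
      (∀ x, ∀ s ∈ path x, ∃ x' x'' : Site P 0, path x'' = path x' ++ [s] ∧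
        (s.fwd = true → s.bond.src = x' ∧ s.bond.tgt = x'') ∧ (s.fwd = false → s.bond.src = x'' ∧ s.bond.tgt = x')) ∧
      (∀ j, j ≤ k → ∀ c ∈ bondsOf (𝔹 j), path (embIter j c.src) = [] ∧ path (embIter j c.tgt) = []) ∧
      (∀ x : Site P 0, x ∉ {z : Site P 0 | ∃ j, j ≤ k ∧ ∃ c ∈ bondsOf (𝔹 j), (z = embIter j c.src ∨ z = embIter j c.tgt)} →
        ∃ (x' : Site P 0) (s : LStep P 0), path x = path x' ++ [s] ∧
          (s.fwd = true → s.bond.src = x' ∧ s.bond.tgt = x) ∧ (s.fwd = false → s.bond.src = x ∧ s.bond.tgt = x')) ∧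
      (∀ (z : Site P 0) (j : ℕ), j ≤ k →
        embIter j (iterBlockOf j z) ∈ {z : Site P 0 | ∃ j, j ≤ k ∧ ∃ c ∈ bondsOf (𝔹 j), (z = embIter j c.src ∨ z = embIter j c.tgt)} →
        ∀ s ∈ path z, iterBlockOf j s.bond.src = iterBlockOf j z ∧ iterBlockOf j s.bond.tgt = iterBlockOf j z) ∧
      (∀ (z : Site P 0) (j : ℕ), j ≤ k →
        embIter j (iterBlockOf j z) ∈ {z : Site P 0 | ∃ j, j ≤ k ∧ ∃ c ∈ bondsOf (𝔹 j), (z = embIter j c.src ∨ z = embIter j c.tgt)} →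
        (path z).length ≤ ∑ i ∈ Finset.range (j + 1), (P.d * ((P.L ^ i - 1) / 2) + 1)) := by
  classical
  set R : Set (Site P 0) := {z : Site P 0 | ∃ j, j ≤ k ∧ ∃ c ∈ bondsOf (𝔹 j), (z = embIter j c.src ∨ z = embIter j c.tgt)} with hR
  -- the least root level of the tower of a site
  have hex : ∀ z : Site P 0, ∃ n, n ≤ k ∧ embIter n (iterBlockOf n z) ∈ R := fun z => by
    obtain ⟨j, hj, hz⟩ := hcov z
    exact ⟨j, hj, j, hj, ⟨iterBlockOf j z, ⟨0, P.hd⟩⟩, Or.inl hz, Or.inl rfl⟩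
  let nz : Site P 0 → ℕ := fun z => Nat.find (hex z)
  have hnz : ∀ z, nz z ≤ k ∧ embIter (nz z) (iterBlockOf (nz z) z) ∈ R := fun z => Nat.find_spec (hex z)
  have hmin : ∀ z j, j ≤ k → embIter j (iterBlockOf j z) ∈ R → nz z ≤ j := fun z j hj hmem => Nat.find_min' (hex z) ⟨hj, hmem⟩
  -- the rank
  let S : ℕ → ℕ := fun n => ∑ i ∈ Finset.range n, (P.d * ((P.L ^ i - 1) / 2) + 1)
  have hS_succ : ∀ n, S (n + 1) = S n + (P.d * ((P.L ^ n - 1) / 2) + 1) := fun n => Finset.sum_range_succ _ n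
  have hS_mono : ∀ {a b}, a ≤ b → S a ≤ S b := fun {a b} hab =>
    Finset.sum_le_sum_of_subset (Finset.range_subset_range.2 hab)
  let ρ : Site P 0 → ℕ := fun z => Site.tdist z (embIter (nz z) (iterBlockOf (nz z) z)) + S (nz z)
  have hρle : ∀ z j, j ≤ k → embIter j (iterBlockOf j z) ∈ R → ρ z + 1 ≤ S (j + 1) := fun z j hj hmem => by
    have hn := hmin z j hj hmem
    have ht := tdist_embIter_iterBlockOf_le ((hnz z).1.trans hk) z
    have h1 : ρ z + 1 ≤ S (nz z + 1) := by
      show Site.tdist z (embIter (nz z) (iterBlockOf (nz z) z)) + S (nz z) + 1 ≤ S (nz z + 1)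
      rw [hS_succ]; omega
    exact h1.trans (hS_mono (by omega))
  -- ranked parents with the edge predicate «same `j`-block for every root level `j` of the child»
  obtain ⟨path, hroot, htree, hlen⟩ := exists_forest_of_rankedParents R ρ
    (fun x' x => ∀ j, j ≤ k → embIter j (iterBlockOf j x) ∈ R → iterBlockOf j x' = iterBlockOf j x) (fun x hxR => by
      obtain ⟨hnk, hmem⟩ := hnz x
      have hne : x ≠ embIter (nz x) (iterBlockOf (nz x) x) := fun h => hxR (h ▸ hmem)
      obtain ⟨x', l, hwalk, hblk, hdist⟩ := exists_parent_toward_centre (hnk.trans hk) hne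
      have hmem' : embIter (nz x) (iterBlockOf (nz x) x') ∈ R := by rw [hblk]; exact hmem
      have hn' : nz x' ≤ nz x := hmin x' (nz x) hnk hmem'
      refine ⟨x', l, ?_, hwalk, fun j hj hj' => iterBlockOf_congr_of_le (hmin x j hj hj') hblk⟩
      show Site.tdist x' (embIter (nz x') (iterBlockOf (nz x') x')) + S (nz x') < Site.tdist x (embIter (nz x) (iterBlockOf (nz x) x)) + S (nz x)
      rcases hn'.lt_or_eq with hlt | heq
      · have ht := tdist_embIter_iterBlockOf_le ((hnz x').1.trans hk) x'
        have h1 : Site.tdist x' (embIter (nz x') (iterBlockOf (nz x') x')) + S (nz x') + 1 ≤ S (nz x' + 1) := by rw [hS_succ]; omega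
        have h2 : S (nz x' + 1) ≤ S (nz x) := hS_mono (by omega)
        omega
      · rw [heq, hblk]
        omega)
  refine ⟨path, forest_F1 hroot (fun x hx => ?_), fun j hj c hc => ⟨hroot _ ⟨j, hj, c, hc, Or.inl rfl⟩, hroot _ ⟨j, hj, c, hc, Or.inr rfl⟩⟩,
    fun x hx => ?_, fun z j hj hmem => ?_, fun z j hj hmem => ?_⟩
  · obtain ⟨x', s, hpx, hor, -, -⟩ := htree x hx
    exact ⟨x', s, hpx, hor⟩
  · obtain ⟨x', s, hpx, hor, -, -⟩ := htree x hx
    exact ⟨x', s, hpx, hor⟩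
  · -- (TOWER) by induction along the path
    have key : ∀ (n : ℕ) (z : Site P 0), (path z).length = n → embIter j (iterBlockOf j z) ∈ R →
        ∀ s ∈ path z, iterBlockOf j s.bond.src = iterBlockOf j z ∧ iterBlockOf j s.bond.tgt = iterBlockOf j z := by
      intro n
      induction' n using Nat.strong_induction_on with n ih
      intro z hn hmemz s hs
      by_cases hzR : z ∈ R
      · rw [hroot z hzR] at hs
        simp at hs
      · obtain ⟨z', t, hpz, hor, hE, -⟩ := htree z hzR
        have hblk : iterBlockOf j z' = iterBlockOf j z := hE j hj hmemz
        rw [hpz, List.mem_append, List.mem_singleton] at hs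
        rcases hs with hs | rfl
        · have hmemz' : embIter j (iterBlockOf j z') ∈ R := by rw [hblk]; exact hmemz
          have hlt : (path z').length < n := by rw [← hn, hpz, List.length_append, List.length_singleton]; omega
          obtain ⟨h1, h2⟩ := ih _ hlt z' rfl hmemz' s hs
          exact ⟨h1.trans hblk, h2.trans hblk⟩
        · cases h : s.fwd
          · obtain ⟨hsrc, htgt⟩ := hor.2 h
            rw [hsrc, htgt]
            exact ⟨rfl, hblk⟩
          · obtain ⟨hsrc, htgt⟩ := hor.1 h
            rw [hsrc, htgt]
            exact ⟨hblk, rfl⟩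
    exact key _ z rfl hmem
  · exact (Nat.le_succ_of_le (hlen z)).trans (hρle z j hj hmem)

/-- ★★★ **THE TOWER-CONFINED FOREST AT THE RECORD's `𝐁_k(Z)`, EVERY `Z`** ((Cov) by `N12FlatHndRecordLetters.hcov_Bj`): (F1) ∧ (F2) ∧ (TREE) at `R(𝐁_k(Z), k)`, and for every member tower of a site
(`iterBlockOf j z ∈ 𝐁_k(Z) j`, `j ≤ k`) the whole path of `z` stays in the `j`-block of `z` and has length `≤ Σ_{i ≤ j} (d·(L^i − 1)∕2 + 1)` — the forest in which the bonds between two sites of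
one basin close their loops inside one block (the (q2) ∕ NAS bookkeeping geometry). [cite: Balaban1988Convergent, (2.2) p.255, (2.13) pp.256–257; Balaban1985RegularSpaces, (1.19) p.79; Balaban1987RG1, (0.1)–(0.3) pp.251–252] -/
theorem exists_towerForest_Bj {k M₁ : ℕ} {Z : Set (Site P 0)} (hk : k ≤ P.m + P.K) (hk1 : 1 ≤ k) (hM : 1 ≤ M₁) (hdiv : side P.L M₁ k ∣ P.sitesPerDir 0) :
    ∃ path : Site P 0 → List (LStep P 0),
      (∀ x, ∀ s ∈ path x, ∃ x' x'' : Site P 0, path x'' = path x' ++ [s] ∧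
        (s.fwd = true → s.bond.src = x' ∧ s.bond.tgt = x'') ∧ (s.fwd = false → s.bond.src = x'' ∧ s.bond.tgt = x')) ∧
      (∀ j, j ≤ k → ∀ c ∈ bondsOf ((Bj M₁ Z k : DetSet P) j), path (embIter j c.src) = [] ∧ path (embIter j c.tgt) = []) ∧
      (∀ x : Site P 0, x ∉ {z : Site P 0 | ∃ j, j ≤ k ∧ ∃ c ∈ bondsOf ((Bj M₁ Z k : DetSet P) j), (z = embIter j c.src ∨ z = embIter j c.tgt)} →
        ∃ (x' : Site P 0) (s : LStep P 0), path x = path x' ++ [s] ∧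
          (s.fwd = true → s.bond.src = x' ∧ s.bond.tgt = x) ∧ (s.fwd = false → s.bond.src = x ∧ s.bond.tgt = x')) ∧
      (∀ (z : Site P 0) (j : ℕ), j ≤ k → iterBlockOf j z ∈ (Bj M₁ Z k : DetSet P) j →
        (∀ s ∈ path z, iterBlockOf j s.bond.src = iterBlockOf j z ∧ iterBlockOf j s.bond.tgt = iterBlockOf j z) ∧
        (path z).length ≤ ∑ i ∈ Finset.range (j + 1), (P.d * ((P.L ^ i - 1) / 2) + 1)) ∧
      (∀ z : Site P 0, ∃ j, j ≤ k ∧ (∀ s ∈ path z, iterBlockOf j s.bond.src = iterBlockOf j z ∧ iterBlockOf j s.bond.tgt = iterBlockOf j z) ∧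
        (path z).length ≤ ∑ i ∈ Finset.range (j + 1), (P.d * ((P.L ^ i - 1) / 2) + 1)) := by
  have hcov := N12FlatHndRecordLetters.hcov_Bj hM hk1 hk hdiv (Z := Z)
  obtain ⟨path, h1, h2, h3, h4, h5⟩ := exists_towerForest (Bj M₁ Z k) hk hcov
  have hmem : ∀ (z : Site P 0) (j : ℕ), j ≤ k → iterBlockOf j z ∈ (Bj M₁ Z k : DetSet P) j →
      embIter j (iterBlockOf j z) ∈ {z : Site P 0 | ∃ j, j ≤ k ∧ ∃ c ∈ bondsOf ((Bj M₁ Z k : DetSet P) j), (z = embIter j c.src ∨ z = embIter j c.tgt)} :=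
    fun z j hj hz => ⟨j, hj, ⟨iterBlockOf j z, ⟨0, P.hd⟩⟩, Or.inl hz, Or.inl rfl⟩
  refine ⟨path, h1, h2, h3, fun z j hj hz => ⟨h4 z j hj (hmem z j hj hz), h5 z j hj (hmem z j hj hz)⟩, fun z => ?_⟩
  obtain ⟨j, hj, hz⟩ := hcov z
  exact ⟨j, hj, h4 z j hj (hmem z j hj hz), h5 z j hj (hmem z j hj hz)⟩

end Tower

end Summit.QuantumFields.YangMills.BalabanUVNodes.N12TowerForest

end
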